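import Summits.Ventures.LatticeQCDFlow.Scaling.LadderPoincare
import Summits.Ventures.LatticeQCDFlow.Scaling.SimulatedTemperingFiniteSampler

/-!
HONEST FRAMING: exact (Metropolis-corrected) sampling algorithms for lattice gauge theory; figures
of merit are autocorrelation/cost numbers at stated couplings and volumes; no continuum-physics
claim.

# SpiderPoincare — A POINCARÉ INEQUALITY FOR A REVERSIBLE CHAIN ON `Fin (K+1) × J` WHOSE ONLY ASSUMED EDGES
# ARE ONE LADDER PER ARM `j` AND THE ROOT ROW `0`: `C·Var_m(g) ≤ 𝓔_m(Q; g)` FOR `C·K(K+1) ≤ pκ`,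
# `2C(K+1) ≤ pρθ` (persistence `p`, vertical flows `≥ κ·min`, root-row Poincaré constant `ρθ`) (lean-2 GEN-17, ours)

Venture-side (OURS).  Cell `lqcd-flow` (pub-lqcd), unit `pub-lqcd-lean-2-g17`, 2026-08-25.  The generic estimate
behind chapter Y (`Scaling/SimulatedTemperingMode*`): the projection chain of the simulated-tempering sampler along
the (level, mode) blocks lives on `Fin (K+1) × J` (level `k`, mode `j`); its flows run along the overlap ladder of
each mode ("arm") and, inside each level, between modes; the HOTTEST level `k = 0` ("root row") is where modes are
supposed to communicate.  This file bounds the Poincaré constant of ANY reversible chain `Q` (law `m`) on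
`Fin (K+1) × J` from three numbers, using only the arm edges and the root row:

* persistence `p ∈ (0,1]`: `p·m(l, j) ≤ m(k, j)` whenever `k ≤ l` (down each arm the masses never exceed `1/p` times
  an earlier mass — for tempering: a mode keeps at least the fraction `p` of its weight when heated);
* vertical conductance `κ > 0`: the flow `m(l,j)Q((l,j),(l+1,j)) ≥ κ·min{m(l,j), m(l+1,j)}` along every arm edge;
* a root-row Poincaré constant: the root row is `m(0, j) = M₀·ν(j)` for a probability vector `ν` on `J`, some
  `ν`-reversible comparison chain `Q₀` on `J` has `ρ·Var_ν(h) ≤ 𝓔_ν(Q₀; h)`, and its flows are dominated,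
  `θ·M₀·ν(j)Q₀(j,j′) ≤ m(0,j)Q((0,j),(0,j′))` (`j ≠ j′`).

## What is proved

* §1 `sq_sub_head_le` — `(g k − g 0)² ≤ k·Σ_{l<k}(g(l+1) − g l)²` (Cauchy–Schwarz); `sum_fin_level_cast`.
* §2 **`spider_arm_le`** — along one arm, `Σ_k m(k,j)(g(k,j) − g(0,j))² ≤ (K(K+1)/(2pκ))·Σ_{l<K} φ_{l,j}(Δ_{l,j}g)²`
  (`φ_{l,j}` the arm flows); **`spider_root_le`** — `Σ_j (Σ_k m(k,j))(g(0,j) − c)² ≤ ((K+1)/(pρθ))·𝓗(g)`, `c` the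
  `ν`-mean of the root row, `𝓗(g) = ½Σ_{j,j′} m(0,j)Q((0,j),(0,j′))(g(0,j) − g(0,j′))²`;
  **`spider_dirichletForm_ge`** — `Σ_{j,l} φ_{l,j}(Δ_{l,j}g)² + 𝓗(g) ≤ 𝓔_m(Q; g)` (reversibility; other flows dropped).
* §3 **`spider_poincare`** — `C·Var_m(g) ≤ 𝓔_m(Q; g)` for every `g` and every `C ≥ 0` with `C·K(K+1) ≤ pκ` and
  `2C(K+1) ≤ pρθ`: the Poincaré constant is at least `(p/(K+1))·min{κ/K, ρθ/2}` — the arm relaxation `K(K+1)/κ` or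
  the root-row relaxation `2(K+1)/(ρθ)`, whichever is slower, divided by the persistence.

NOT CLAIMED: sharp constants; arms of different lengths; communication between arms below the root (extra flows only
help and are dropped); anything about a specific sampler (`Scaling/SimulatedTemperingModeGap`).  Literature grade
(cell rule): KNOWN MECHANISM (path / Cauchy–Schwarz Poincaré bounds on trees; the persistence parameter of
Woodard–Schmidler–Huber, Ann. Appl. Probab. 19 (2009) 617–640, Electron. J. Probab. 14 (2009) 780–804), NEW TYPING
(explicit constants, general root-row chain); nothing cited as a fact; no new bib keys.
-/

noncomputable section

open Finset
open Literature.Probability.MarkovChains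
open Literature.Probability.MarkovChains.Decomposition

namespace Summit.Ventures.LatticeQCDFlow.Scaling

/-! ## §1 Ladder arithmetic -/

section Arith

variable {K : ℕ}

/-- **Cauchy–Schwarz along an arm:** `(g k − g 0)² ≤ k·Σ_{l<k}(g(l+1) − g l)²` (the sum written over `Fin K` with
the indicator `[l < k]`). [folklore] -/
theorem sq_sub_head_le (g : Fin (K + 1) → ℝ) (k : Fin (K + 1)) :
    (g k - g 0) ^ 2
      ≤ (k : ℝ) * ∑ l : Fin K, (if l.val < k.val then (g l.succ - g l.castSucc) ^ 2 else 0) := by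
  set u : ℕ → ℝ := fun n => if h : n < K + 1 then g ⟨n, h⟩ else 0 with hu
  have hk : g k = u k := by rw [hu]; simp [k.2]
  have h0 : g 0 = u 0 := by rw [hu]; simp
  have hsum : ∑ l : Fin K, (if l.val < k.val then (g l.succ - g l.castSucc) ^ 2 else 0)
      = ∑ l ∈ Finset.range k, (u (l + 1) - u l) ^ 2 := by
    have e1 : ∑ l : Fin K, (if l.val < k.val then (g l.succ - g l.castSucc) ^ 2 else 0)
        = ∑ l ∈ Finset.range K, (if l < k.val then (u (l + 1) - u l) ^ 2 else 0) := by
      rw [← Fin.sum_univ_eq_sum_range (fun l => if l < k.val then (u (l + 1) - u l) ^ 2 else 0) K]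
      refine sum_congr rfl fun l _ => ?_
      have h1 : g l.succ = u (l + 1) := by
        rw [hu]; simp only [show (l : ℕ) + 1 < K + 1 by omega, dite_true]; rfl
      have h2 : g l.castSucc = u l := by
        rw [hu]; simp only [show (l : ℕ) < K + 1 by omega, dite_true]; rfl
      rw [h1, h2]
    rw [e1, ← Finset.sum_filter]
    congr 1
    ext l
    simp only [Finset.mem_filter, Finset.mem_range]
    have := k.2
    omega
  rw [hk, h0, hsum, ← Finset.sum_range_sub u k]
  have hcs := sq_sum_le_card_mul_sum_sq (s := Finset.range k) (f := fun l => u (l + 1) - u l)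
  rw [Finset.card_range] at hcs
  exact hcs

/-- `Σ_{k ≤ K} k = K(K+1)/2`. [folklore] -/
theorem sum_fin_level_cast (K : ℕ) : ∑ k : Fin (K + 1), (k : ℝ) = K * (K + 1) / 2 := by
  rw [Fin.sum_univ_eq_sum_range (fun i => (i : ℝ)) (K + 1)]
  have h2 := Finset.sum_range_id_mul_two (K + 1)
  have h3 : (∑ i ∈ Finset.range (K + 1), (i : ℝ)) * 2 = (K + 1) * K := by
    rw [show (∑ i ∈ Finset.range (K + 1), (i : ℝ)) = ((∑ i ∈ Finset.range (K + 1), i : ℕ) : ℝ) by push_cast; rfl]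
    exact_mod_cast h2
  linarith

end Arith

/-! ## §2 The spider: arm bound, root bound, kept flows -/

section Spider

variable {J : Type*} [Fintype J] [DecidableEq J] {K : ℕ} {m : Fin (K + 1) × J → ℝ}
  {Q : Matrix (Fin (K + 1) × J) (Fin (K + 1) × J) ℝ}

omit [Fintype J] [DecidableEq J] in
/-- **The arm bound.**  Persistence `p·m(l,j) ≤ m(k,j)` (`k ≤ l`) and vertical flows
`φ_{l,j} = m(l,j)Q((l,j),(l+1,j)) ≥ κ·min{m(l,j), m(l+1,j)}` give, along the arm of mode `j`,
`Σ_k m(k,j)(g(k,j) − g(0,j))² ≤ (K(K+1)/(2pκ))·Σ_{l<K} φ_{l,j}(g(l+1,j) − g(l,j))²`. [ours] -/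
theorem spider_arm_le (hm0 : ∀ b, 0 ≤ m b) {p κ : ℝ} (hp : 0 < p) (hκ : 0 < κ)
    (hpers : ∀ (k l : Fin (K + 1)) (j : J), k ≤ l → p * m (l, j) ≤ m (k, j))
    (hvert : ∀ (l : Fin K) (j : J), κ * min (m (l.castSucc, j)) (m (l.succ, j))
      ≤ m (l.castSucc, j) * Q (l.castSucc, j) (l.succ, j))
    (g : Fin (K + 1) × J → ℝ) (j : J) :
    ∑ k : Fin (K + 1), m (k, j) * (g (k, j) - g (0, j)) ^ 2
      ≤ K * (K + 1) / (2 * p * κ) * ∑ l : Fin K, m (l.castSucc, j) * Q (l.castSucc, j) (l.succ, j)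
          * (g (l.succ, j) - g (l.castSucc, j)) ^ 2 := by
  set D : Fin K → ℝ := fun l => (g (l.succ, j) - g (l.castSucc, j)) ^ 2 with hD
  set φ : Fin K → ℝ := fun l => m (l.castSucc, j) * Q (l.castSucc, j) (l.succ, j) with hφ
  have hD0 : ∀ l, 0 ≤ D l := fun l => sq_nonneg _
  have hφ0 : ∀ l, 0 ≤ φ l := fun l =>
    le_trans (mul_nonneg hκ.le (le_min (hm0 _) (hm0 _))) (hvert l j)
  have hpk : 0 < p * κ := mul_pos hp hκ
  have h1 : ∀ k : Fin (K + 1), m (k, j) * (g (k, j) - g (0, j)) ^ 2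
      ≤ ∑ l : Fin K, (k : ℝ) * (if l.val < k.val then m (k, j) * D l else 0) := by
    intro k
    have hcs := sq_sub_head_le (fun i => g (i, j)) k
    calc m (k, j) * (g (k, j) - g (0, j)) ^ 2
        ≤ m (k, j) * ((k : ℝ) * ∑ l : Fin K, (if l.val < k.val then (g (l.succ, j) - g (l.castSucc, j)) ^ 2 else 0)) :=
          mul_le_mul_of_nonneg_left hcs (hm0 _)
      _ = ∑ l : Fin K, (k : ℝ) * (if l.val < k.val then m (k, j) * D l else 0) := by
          rw [Finset.mul_sum, Finset.mul_sum]
          refine sum_congr rfl fun l _ => ?_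
          split_ifs
          · simp only [hD]; ring
          · simp
  -- persistence: for `l < k`, `m(k,j) ≤ min{m(l,j), m(l+1,j)}/p ≤ φ_l/(pκ)`
  have h2 : ∀ (k : Fin (K + 1)) (l : Fin K),
      (k : ℝ) * (if l.val < k.val then m (k, j) * D l else 0) ≤ (k : ℝ) * (φ l / (p * κ) * D l) := by
    intro k l
    refine mul_le_mul_of_nonneg_left ?_ (Nat.cast_nonneg _)
    split_ifs with hlk
    · refine mul_le_mul_of_nonneg_right ?_ (hD0 l)
      have ha : p * m (k, j) ≤ m (l.castSucc, j) :=
        hpers l.castSucc k j (by rw [Fin.le_iff_val_le_val, Fin.val_castSucc]; omega)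
      have hb : p * m (k, j) ≤ m (l.succ, j) :=
        hpers l.succ k j (by rw [Fin.le_iff_val_le_val, Fin.val_succ]; omega)
      have hmin : p * m (k, j) ≤ min (m (l.castSucc, j)) (m (l.succ, j)) := le_min ha hb
      rw [le_div_iff₀ hpk]
      calc m (k, j) * (p * κ) = κ * (p * m (k, j)) := by ring
        _ ≤ κ * min (m (l.castSucc, j)) (m (l.succ, j)) := mul_le_mul_of_nonneg_left hmin hκ.le
        _ ≤ φ l := hvert l j
    · exact mul_nonneg (div_nonneg (hφ0 l) hpk.le) (hD0 l)
  calc ∑ k : Fin (K + 1), m (k, j) * (g (k, j) - g (0, j)) ^ 2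
      ≤ ∑ k : Fin (K + 1), ∑ l : Fin K, (k : ℝ) * (if l.val < k.val then m (k, j) * D l else 0) :=
        sum_le_sum fun k _ => h1 k
    _ ≤ ∑ k : Fin (K + 1), ∑ l : Fin K, (k : ℝ) * (φ l / (p * κ) * D l) :=
        sum_le_sum fun k _ => sum_le_sum fun l _ => h2 k l
    _ = (∑ k : Fin (K + 1), (k : ℝ)) * ∑ l : Fin K, φ l / (p * κ) * D l := by
        rw [Finset.sum_mul_sum]
    _ = K * (K + 1) / (2 * p * κ) * ∑ l : Fin K, φ l * D l := by
        rw [sum_fin_level_cast, Finset.mul_sum, Finset.mul_sum]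
        refine sum_congr rfl fun l _ => ?_
        field_simp
    _ = K * (K + 1) / (2 * p * κ) * ∑ l : Fin K, m (l.castSucc, j) * Q (l.castSucc, j) (l.succ, j)
          * (g (l.succ, j) - g (l.castSucc, j)) ^ 2 := by
        rfl

/-- **The root bound.**  Persistence from the root (`p·m(k,j) ≤ m(0,j)`), the root row `m(0,j) = M₀ν(j)`, a
Poincaré constant `ρ` of a `ν`-chain `Q₀` on `J` whose flows are dominated by the root-row flows
(`θM₀ν(j)Q₀(j,j′) ≤ m(0,j)Q((0,j),(0,j′))`, `j ≠ j′`) give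
`Σ_j (Σ_k m(k,j))·(g(0,j) − c)² ≤ ((K+1)/(pρθ))·½Σ_{j,j′} m(0,j)Q((0,j),(0,j′))(g(0,j) − g(0,j′))²`
with `c` the `ν`-mean of the root row. [ours] -/
theorem spider_root_le {p ρ θ M₀ : ℝ} (hp : 0 < p) (hρ : 0 < ρ) (hθ : 0 < θ)
    (hM₀ : 0 ≤ M₀) (hpers : ∀ (k l : Fin (K + 1)) (j : J), k ≤ l → p * m (l, j) ≤ m (k, j))
    {ν : J → ℝ} (hrow : ∀ j, m (0, j) = M₀ * ν j) {Q₀ : Matrix J J ℝ}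
    (hroot : ∀ h : J → ℝ, ρ * lawVariance ν h ≤ dirichletForm ν Q₀ h)
    (hdom : ∀ j j', j ≠ j' → θ * (M₀ * (ν j * Q₀ j j')) ≤ m (0, j) * Q (0, j) (0, j'))
    (g : Fin (K + 1) × J → ℝ) :
    ∑ j, (∑ k : Fin (K + 1), m (k, j)) * (g (0, j) - lawMean ν (fun j => g (0, j))) ^ 2
      ≤ (K + 1) / (p * ρ * θ)
          * ((1 / 2) * ∑ j, ∑ j', m (0, j) * Q (0, j) (0, j') * (g (0, j) - g (0, j')) ^ 2) := by
  set h : J → ℝ := fun j => g (0, j) with hh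
  have hcol : ∀ j, ∑ k : Fin (K + 1), m (k, j) ≤ (K + 1) * (M₀ * ν j) / p := by
    intro j
    rw [le_div_iff₀ hp, ← hrow]
    calc (∑ k : Fin (K + 1), m (k, j)) * p = ∑ k : Fin (K + 1), p * m (k, j) := by
          rw [Finset.sum_mul]; exact sum_congr rfl fun k _ => mul_comm _ _
      _ ≤ ∑ _k : Fin (K + 1), m (0, j) := sum_le_sum fun k _ => hpers 0 k j (Fin.zero_le _)
      _ = (K + 1) * m (0, j) := by
          rw [sum_const, card_univ, Fintype.card_fin, nsmul_eq_mul]; push_cast; ring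
  have s1 : ∑ j, (∑ k : Fin (K + 1), m (k, j)) * (g (0, j) - lawMean ν h) ^ 2
      ≤ (K + 1) * M₀ / p * lawVariance ν h := by
    unfold lawVariance
    rw [Finset.mul_sum]
    refine sum_le_sum fun j _ => ?_
    calc (∑ k : Fin (K + 1), m (k, j)) * (g (0, j) - lawMean ν h) ^ 2
        ≤ (K + 1) * (M₀ * ν j) / p * (g (0, j) - lawMean ν h) ^ 2 :=
          mul_le_mul_of_nonneg_right (hcol j) (sq_nonneg _)
      _ = (K + 1) * M₀ / p * (ν j * (h j - lawMean ν h) ^ 2) := by rw [hh]; ring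
  have s2 : lawVariance ν h ≤ dirichletForm ν Q₀ h / ρ := by
    rw [le_div_iff₀ hρ, mul_comm]; exact hroot h
  have s3 : M₀ * dirichletForm ν Q₀ h
      ≤ (1 / θ) * ((1 / 2) * ∑ j, ∑ j', m (0, j) * Q (0, j) (0, j') * (g (0, j) - g (0, j')) ^ 2) := by
    unfold dirichletForm
    have term : ∀ j j', M₀ * (ν j * Q₀ j j' * (h j - h j') ^ 2)
        ≤ (1 / θ) * (m (0, j) * Q (0, j) (0, j') * (g (0, j) - g (0, j')) ^ 2) := by
      intro j j'
      by_cases hjj : j = j'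
      · subst hjj; simp [hh]
      · have hd := hdom j j' hjj
        rw [mul_comm (1 / θ), mul_one_div, le_div_iff₀ hθ, hh]
        calc M₀ * (ν j * Q₀ j j' * (g (0, j) - g (0, j')) ^ 2) * θ
            = θ * (M₀ * (ν j * Q₀ j j')) * (g (0, j) - g (0, j')) ^ 2 := by ring
          _ ≤ m (0, j) * Q (0, j) (0, j') * (g (0, j) - g (0, j')) ^ 2 :=
              mul_le_mul_of_nonneg_right hd (sq_nonneg _)
    calc M₀ * (1 / 2 * ∑ j, ∑ j', ν j * Q₀ j j' * (h j - h j') ^ 2)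
        = 1 / 2 * ∑ j, ∑ j', M₀ * (ν j * Q₀ j j' * (h j - h j') ^ 2) := by
          rw [mul_left_comm, Finset.mul_sum]
          simp_rw [Finset.mul_sum]
      _ ≤ 1 / 2 * ∑ j, ∑ j', (1 / θ) * (m (0, j) * Q (0, j) (0, j') * (g (0, j) - g (0, j')) ^ 2) :=
          mul_le_mul_of_nonneg_left (sum_le_sum fun j _ => sum_le_sum fun j' _ => term j j') (by norm_num)
      _ = (1 / θ) * ((1 / 2) * ∑ j, ∑ j', m (0, j) * Q (0, j) (0, j') * (g (0, j) - g (0, j')) ^ 2) := by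
          rw [mul_left_comm, Finset.mul_sum]
          simp_rw [Finset.mul_sum]
  set H := (1 / 2) * ∑ j, ∑ j', m (0, j) * Q (0, j) (0, j') * (g (0, j) - g (0, j')) ^ 2 with hH
  have hKp : 0 ≤ (K + 1 : ℝ) * M₀ / p := by positivity
  calc ∑ j, (∑ k : Fin (K + 1), m (k, j)) * (g (0, j) - lawMean ν h) ^ 2
      ≤ (K + 1) * M₀ / p * lawVariance ν h := s1
    _ ≤ (K + 1) * M₀ / p * (dirichletForm ν Q₀ h / ρ) := mul_le_mul_of_nonneg_left s2 hKp
    _ = (K + 1) / (p * ρ) * (M₀ * dirichletForm ν Q₀ h) := by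
        field_simp
    _ ≤ (K + 1) / (p * ρ) * ((1 / θ) * H) := mul_le_mul_of_nonneg_left s3 (by positivity)
    _ = (K + 1) / (p * ρ * θ) * H := by
        field_simp

/-- **The kept flows.**  For a reversible chain on `Fin (K+1) × J` with non-negative law and entries, the
Dirichlet form dominates the arm terms plus the root-row terms:
`Σ_{j} Σ_{l<K} m(l,j)Q((l,j),(l+1,j))(g(l+1,j) − g(l,j))² + ½Σ_{j,j′} m(0,j)Q((0,j),(0,j′))(g(0,j) − g(0,j′))²
≤ 𝓔_m(Q; g)` (every other flow is dropped). [ours] -/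
theorem spider_dirichletForm_ge (hm0 : ∀ b, 0 ≤ m b) (hQ0 : ∀ b b', 0 ≤ Q b b') (hDB : DetailedBalance m Q)
    (g : Fin (K + 1) × J → ℝ) :
    (∑ j, ∑ l : Fin K, m (l.castSucc, j) * Q (l.castSucc, j) (l.succ, j) * (g (l.succ, j) - g (l.castSucc, j)) ^ 2)
      + (1 / 2) * ∑ j, ∑ j', m (0, j) * Q (0, j) (0, j') * (g (0, j) - g (0, j')) ^ 2
      ≤ dirichletForm m Q g := by
  set F : (Fin (K + 1) × J) → (Fin (K + 1) × J) → ℝ := fun b b' => m b * Q b b' * (g b - g b') ^ 2 with hF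
  have hF0 : ∀ b b', 0 ≤ F b b' := fun b b' => mul_nonneg (mul_nonneg (hm0 b) (hQ0 b b')) (sq_nonneg _)
  -- the kept coefficients are dominated termwise
  have hle : ∀ b b' : Fin (K + 1) × J,
      (if b'.2 = b.2 ∧ (b'.1.val = b.1.val + 1 ∨ b.1.val = b'.1.val + 1) then F b b' else 0)
        + (if b.1 = 0 ∧ b'.1 = 0 then F b b' else 0) ≤ F b b' := by
    intro b b'
    by_cases h1 : (b'.2 = b.2 ∧ (b'.1.val = b.1.val + 1 ∨ b.1.val = b'.1.val + 1))
    · have h2 : ¬ (b.1 = 0 ∧ b'.1 = 0) := by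
        rintro ⟨e1, e2⟩
        have := h1.2
        rw [e1, e2] at this
        simp at this
      rw [if_pos h1, if_neg h2, add_zero]
    · rw [if_neg h1, zero_add]
      split_ifs
      · exact le_rfl
      · exact hF0 b b'
  have hsum := sum_le_sum fun b (_ : b ∈ (univ : Finset (Fin (K + 1) × J))) =>
    sum_le_sum fun b' (_ : b' ∈ (univ : Finset (Fin (K + 1) × J))) => hle b b'
  simp_rw [Finset.sum_add_distrib] at hsum
  -- evaluate the arm part: both orientations of every arm edge
  have e1 : ∑ b : Fin (K + 1) × J, ∑ b' : Fin (K + 1) × J,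
      (if b'.2 = b.2 ∧ (b'.1.val = b.1.val + 1 ∨ b.1.val = b'.1.val + 1) then F b b' else 0)
      = 2 * ∑ j, ∑ l : Fin K, m (l.castSucc, j) * Q (l.castSucc, j) (l.succ, j)
          * (g (l.succ, j) - g (l.castSucc, j)) ^ 2 := by
    rw [Fintype.sum_prod_type_right]
    simp_rw [Fintype.sum_prod_type, ite_and]
    have c1 : ∀ (j : J) (i l : Fin (K + 1)),
        ∑ j' : J, (if j' = j then (if (l.val = i.val + 1 ∨ i.val = l.val + 1) then F (i, j) (l, j') else 0) else 0)
        = if (l.val = i.val + 1 ∨ i.val = l.val + 1) then F (i, j) (l, j) else 0 := by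
      intro j i l
      rw [Finset.sum_ite_eq' univ j, if_pos (mem_univ _)]
    simp_rw [c1]
    rw [Finset.mul_sum]
    refine sum_congr rfl fun j _ => ?_
    have c2 : ∀ i l : Fin (K + 1), (if (l.val = i.val + 1 ∨ i.val = l.val + 1) then F (i, j) (l, j) else 0)
        = (if l.val = i.val + 1 then F (i, j) (l, j) else 0) + (if i.val = l.val + 1 then F (i, j) (l, j) else 0) := by
      intro i l
      by_cases ha : l.val = i.val + 1
      · rw [if_pos (Or.inl ha), if_pos ha, if_neg (by omega), add_zero]
      · by_cases hb : i.val = l.val + 1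
        · rw [if_pos (Or.inr hb), if_neg ha, if_pos hb, zero_add]
        · rw [if_neg (by omega), if_neg ha, if_neg hb, add_zero]
    simp_rw [c2, Finset.sum_add_distrib]
    rw [sum_sum_ite_val_succ (fun i l => F (i, j) (l, j)), sum_sum_ite_val_pred (fun i l => F (i, j) (l, j)),
      two_mul]
    congr 1
    · refine sum_congr rfl fun l _ => ?_
      simp only [hF]
      ring
    · refine sum_congr rfl fun l _ => ?_
      simp only [hF]
      rw [hDB (l.succ, j) (l.castSucc, j)]
  have e2 : ∑ b : Fin (K + 1) × J, ∑ b' : Fin (K + 1) × J, (if b.1 = 0 ∧ b'.1 = 0 then F b b' else 0)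
      = ∑ j, ∑ j', m (0, j) * Q (0, j) (0, j') * (g (0, j) - g (0, j')) ^ 2 := by
    have step : ∀ b : Fin (K + 1) × J, ∑ b' : Fin (K + 1) × J, (if b.1 = 0 ∧ b'.1 = 0 then F b b' else 0)
        = if b.1 = 0 then ∑ j', F b (0, j') else 0 := by
      intro b
      simp_rw [ite_and, Finset.sum_ite_irrel, Finset.sum_const_zero]
      rw [sum_ite_fst_eq (0 : Fin (K + 1)) (fun b' => F b b')]
    simp_rw [step]
    rw [sum_ite_fst_eq (0 : Fin (K + 1)) (fun b => ∑ j', F b (0, j'))]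
  rw [e1, e2] at hsum
  unfold dirichletForm
  have : (1 : ℝ) / 2 * (2 * ∑ j, ∑ l : Fin K, m (l.castSucc, j) * Q (l.castSucc, j) (l.succ, j)
      * (g (l.succ, j) - g (l.castSucc, j)) ^ 2
      + ∑ j, ∑ j', m (0, j) * Q (0, j) (0, j') * (g (0, j) - g (0, j')) ^ 2)
      ≤ (1 : ℝ) / 2 * ∑ b, ∑ b', F b b' := mul_le_mul_of_nonneg_left hsum (by norm_num)
  simp only [hF] at this
  linarith

/-! ## §3 The spider Poincaré inequality -/

/-- **THE SPIDER POINCARÉ INEQUALITY.**  `m ≥ 0` a probability vector on `Fin (K+1) × J`, `Q ≥ 0` `m`-reversible;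
persistence `p·m(l,j) ≤ m(k,j)` (`k ≤ l`, `0 < p`); vertical flows `≥ κ·min{m(l,j), m(l+1,j)}` (`0 < κ`); root row
`m(0,j) = M₀ν(j)` (`M₀ ≥ 0`, `ν ≥ 0`) with a `ν`-chain `Q₀` of Poincaré constant `ρ > 0` whose flows are dominated
by the root-row flows up to `θ > 0`.  Then for every `C ≥ 0` with `C·K(K+1) ≤ pκ` and `2C(K+1) ≤ pρθ`:
**`C·Var_m(g) ≤ 𝓔_m(Q; g)`** for every `g`. [ours] -/
theorem spider_poincare (hm0 : ∀ b, 0 ≤ m b) (hm1 : ∑ b, m b = 1) (hQ0 : ∀ b b', 0 ≤ Q b b')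
    (hDB : DetailedBalance m Q) {p κ ρ θ M₀ : ℝ} (hp : 0 < p) (hκ : 0 < κ) (hρ : 0 < ρ) (hθ : 0 < θ)
    (hM₀ : 0 ≤ M₀) (hpers : ∀ (k l : Fin (K + 1)) (j : J), k ≤ l → p * m (l, j) ≤ m (k, j))
    (hvert : ∀ (l : Fin K) (j : J), κ * min (m (l.castSucc, j)) (m (l.succ, j))
      ≤ m (l.castSucc, j) * Q (l.castSucc, j) (l.succ, j))
    {ν : J → ℝ} (hrow : ∀ j, m (0, j) = M₀ * ν j) {Q₀ : Matrix J J ℝ}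
    (hroot : ∀ h : J → ℝ, ρ * lawVariance ν h ≤ dirichletForm ν Q₀ h)
    (hdom : ∀ j j', j ≠ j' → θ * (M₀ * (ν j * Q₀ j j')) ≤ m (0, j) * Q (0, j) (0, j'))
    {C : ℝ} (hC0 : 0 ≤ C) (hC1 : C * (K * (K + 1)) ≤ p * κ) (hC2 : C * (2 * (K + 1)) ≤ p * ρ * θ)
    (g : Fin (K + 1) × J → ℝ) :
    C * lawVariance m g ≤ dirichletForm m Q g := by
  set c := lawMean ν (fun j => g (0, j)) with hc
  set V := ∑ j, ∑ l : Fin K, m (l.castSucc, j) * Q (l.castSucc, j) (l.succ, j)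
    * (g (l.succ, j) - g (l.castSucc, j)) ^ 2 with hV
  set H := (1 / 2) * ∑ j, ∑ j', m (0, j) * Q (0, j) (0, j') * (g (0, j) - g (0, j')) ^ 2 with hH
  have hV0 : 0 ≤ V := sum_nonneg fun j _ => sum_nonneg fun l _ =>
    mul_nonneg (mul_nonneg (hm0 _) (hQ0 _ _)) (sq_nonneg _)
  have hH0 : 0 ≤ H := mul_nonneg (by norm_num) (sum_nonneg fun j _ => sum_nonneg fun j' _ =>
    mul_nonneg (mul_nonneg (hm0 _) (hQ0 _ _)) (sq_nonneg _))
  -- Var ≤ A + B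
  have hvar : lawVariance m g
      ≤ 2 * ∑ j, ∑ k : Fin (K + 1), m (k, j) * (g (k, j) - g (0, j)) ^ 2
        + 2 * ∑ j, (∑ k : Fin (K + 1), m (k, j)) * (g (0, j) - c) ^ 2 := by
    calc lawVariance m g ≤ ∑ b, m b * (g b - c) ^ 2 := lawVariance_le_sum_sq_sub hm1 g c
      _ = ∑ j, ∑ k : Fin (K + 1), m (k, j) * (g (k, j) - c) ^ 2 := Fintype.sum_prod_type_right _
      _ ≤ ∑ j, ∑ k : Fin (K + 1), m (k, j) * (2 * (g (k, j) - g (0, j)) ^ 2 + 2 * (g (0, j) - c) ^ 2) :=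
          sum_le_sum fun j _ => sum_le_sum fun k _ =>
            mul_le_mul_of_nonneg_left (by nlinarith [sq_nonneg (g (k, j) - 2 * g (0, j) + c)]) (hm0 _)
      _ = 2 * ∑ j, ∑ k : Fin (K + 1), m (k, j) * (g (k, j) - g (0, j)) ^ 2
            + 2 * ∑ j, (∑ k : Fin (K + 1), m (k, j)) * (g (0, j) - c) ^ 2 := by
          rw [Finset.mul_sum, Finset.mul_sum, ← Finset.sum_add_distrib]
          refine sum_congr rfl fun j _ => ?_
          rw [Finset.mul_sum, Finset.sum_mul, Finset.mul_sum, ← Finset.sum_add_distrib]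
          refine sum_congr rfl fun k _ => ?_
          ring
  -- A ≤ (K(K+1)/(2pκ))·V, B ≤ ((K+1)/(pρθ))·H
  have hA : ∑ j, ∑ k : Fin (K + 1), m (k, j) * (g (k, j) - g (0, j)) ^ 2 ≤ K * (K + 1) / (2 * p * κ) * V := by
    rw [hV, Finset.mul_sum]
    exact sum_le_sum fun j _ => spider_arm_le hm0 hp hκ hpers hvert g j
  have hB : ∑ j, (∑ k : Fin (K + 1), m (k, j)) * (g (0, j) - c) ^ 2 ≤ (K + 1) / (p * ρ * θ) * H :=
    spider_root_le hp hρ hθ hM₀ hpers hrow hroot hdom g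
  have hE : V + H ≤ dirichletForm m Q g := spider_dirichletForm_ge hm0 hQ0 hDB g
  have hpk : 0 < p * κ := mul_pos hp hκ
  have hprt : 0 < p * ρ * θ := mul_pos (mul_pos hp hρ) hθ
  have k1 : C * (2 * (K * (K + 1) / (2 * p * κ) * V)) ≤ V := by
    have e : C * (2 * (K * (K + 1) / (2 * p * κ) * V)) = (C * (K * (K + 1))) / (p * κ) * V := by
      field_simp
    rw [e]
    calc C * (K * (K + 1)) / (p * κ) * V ≤ 1 * V :=
          mul_le_mul_of_nonneg_right ((div_le_one hpk).mpr hC1) hV0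
      _ = V := one_mul V
  have k2 : C * (2 * ((K + 1) / (p * ρ * θ) * H)) ≤ H := by
    have e : C * (2 * ((K + 1) / (p * ρ * θ) * H)) = (C * (2 * (K + 1))) / (p * ρ * θ) * H := by
      field_simp
    rw [e]
    calc C * (2 * (K + 1)) / (p * ρ * θ) * H ≤ 1 * H :=
          mul_le_mul_of_nonneg_right ((div_le_one hprt).mpr hC2) hH0
      _ = H := one_mul H
  calc C * lawVariance m g
      ≤ C * (2 * ∑ j, ∑ k : Fin (K + 1), m (k, j) * (g (k, j) - g (0, j)) ^ 2
          + 2 * ∑ j, (∑ k : Fin (K + 1), m (k, j)) * (g (0, j) - c) ^ 2) := mul_le_mul_of_nonneg_left hvar hC0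
    _ ≤ C * (2 * (K * (K + 1) / (2 * p * κ) * V) + 2 * ((K + 1) / (p * ρ * θ) * H)) := by
        refine mul_le_mul_of_nonneg_left ?_ hC0
        linarith
    _ = C * (2 * (K * (K + 1) / (2 * p * κ) * V)) + C * (2 * ((K + 1) / (p * ρ * θ) * H)) := by ring
    _ ≤ V + H := add_le_add k1 k2
    _ ≤ dirichletForm m Q g := hE

end Spider

end Summit.Ventures.LatticeQCDFlow.Scaling

end
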